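/-
Origin: expansion seat `planner-pub-hodgecm-toy2-0`, handover 2026-08-18T03:26:33Z / #2 03:32:46Z (`HOME/pub-hodgecm-toy2/lean/Models/PeriodFree.lean`, md5 b9240716, 249 lines);
landed by the gen-5 packager in gate run 18 as `HodgeCM/Model/PeriodFree.lean` (verbatim).
-/
/-
Copyright: pub-hodgecm formalisation cell (harness21, 2026). New file (not vendored).
Origin: HOME/pub-hodgecm-toy2/lean/Models/PeriodFree.lean (WIP module `Models.PeriodFree`; intended final place
`HodgeCM/Model/PeriodFree.lean` = module `HodgeCM.Model.PeriodFree`, CONTRIBUTING §3 L5) (seat planner-pub-hodgecm-toy2-0, consistency seat 2,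
part (6a)(ii): non-vacuity of the open inputs).
-/
import Summits.HodgeConjecture.HodgeCM.Assembly.CorCM

/-!
# The period-free shadow of a universe: the realisation inputs carry PerL's content

For ANY geometric universe `U` (`HodgeCM.Geometry.Universe`) let `U.periodFree` be the universe with the SAME
varieties, cohomology, Hodge structures, algebraic classes, morphisms, products, CM data and Picard modular
surfaces, but with the trace functional replaced by zero (`tr := 0`).  This file proves, with no hypothesis on `U`
beyond the ones named:

1. `ModelAxioms.periodFree` — if `U` satisfies the 28 model facts then so does `U.periodFree` (only
   `Fact_tr_degree`, `Fact_gysin_surface`, `Fact_deg_diag` mention `tr`, and each holds trivially for `tr = 0`).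
2. In `U.periodFree` every quadrilinear period vanishes (`periodFree_period`), so the conclusion shape `PeriodNV` of
   PerL Thm 4.4 / rfwf Thm 4.1 is FALSE for every datum (`not_periodNV_periodFree`), and the theta-realisation
   structure is EMPTY for every datum (`isEmpty_thetaRealisation_periodFree`: `inner_Λ` (Petersson = period) and
   `lineField` (a nonzero wedge) are jointly unsatisfiable when all periods vanish; needs only `Fact_pull_hodge`).
3. The statements that do not mention `tr` are LITERALLY unchanged: `HC_CM`, `PohlmannSpan`, `Qw8Sufficiency`,
   `W_RK4`, `FaceReduction`, `Lemma81`, `WeilFaceAlgebraic` (`periodFree_*_iff`, all `Iff.rfl`), and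
   `SurfaceCriterion` holds vacuously.
4. Hence in `U.periodFree` each of `PerL`, `PerL44`, `RealisationExistsPerL` holds IFF PerL's hypotheses are
   uninhabited (`HodgeCM.PerLHypothesesInhabited`), and each of `PeriodThmF`, `RealisationExistsFace` holds IFF the
   face hypotheses are uninhabited (`HodgeCM.FaceHypothesesInhabited`; the latter IS inhabited — `ℚ(ζ₇)` —, proved in
   `HodgeCM.Model.Inhabited`).

CONSEQUENCE (`HodgeCM.Model.NonVacuity`): if some universe satisfies `ModelAxioms` (resp. `ModelAxioms` and all four
`OpenInputs`), then some universe satisfies `ModelAxioms` (resp. `ModelAxioms ∧ PohlmannSpan ∧ Qw8Sufficiency ∧ W_RK4 ∧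
HC_CM`) and REFUTES `RealisationExistsFace`, `PeriodThmF` — and, granted that PerL's hypotheses are inhabited, also
`RealisationExistsPerL`, `PerL44` and `PerL` itself.  So the headline `HodgeCM.Assembly.perL (M) (hR)` does not
follow from `M` (nor from `M` + the two reduction inputs + COR-CM): the open input `hR : RealisationExistsPerL` is
where the content of PerL sits, and it is not a consequence of the model facts.  (It says nothing about whether
`hR` holds in the INTENDED model — that is PerL v5 §§3–4, under adjudication.)

Nothing in this file is specific to a concrete model; the exterior ("toy") model of the sibling seat has `tr = 0`
already, so it is its own period-free shadow.
-/

noncomputable section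

open scoped TensorProduct InnerProductSpace

namespace HodgeCM

open Literature.AlgebraicGeometry.Motives (CMType)

/-! ### Inhabitedness of the hypotheses of PerL and of the face statements (pure number theory, `U`-free) -/

/-- **PerL's hypotheses are inhabited**: there are a sextic CM field `K`, a CM field `L` that is a normal closure
of `K/ℚ` with `[L:ℚ] ∈ {24, 48}`, `j : K →+* L`, a frame `φ` of `K`, an embedding `ι₁ : L →+* ℂ` extending `φ 0`,
and four CM types realising PerL's sign table.  (TRUE in mathematics — e.g. `K = K₀(√-β)` for a totally real
non-Galois cubic `K₀` and a generic totally positive `β ∈ K₀`, whose Galois closure has group `(ℤ/2)³ ⋊ S₃` of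
order 48 —, but NOT proved in this package: constructing such a field with its Galois closure in Lean/Mathlib is
out of scope.  It enters the non-vacuity theorems as an explicit hypothesis.) -/
def PerLHypothesesInhabited : Prop :=
  ∃ (K L : CMField) (j : K →+* L), IsNormalClosure ℚ K L ∧ Module.finrank ℚ K = 6 ∧
    (Module.finrank ℚ L = 24 ∨ Module.finrank ℚ L = 48) ∧
    ∃ φ : Fin 3 → (K →+* ℂ), IsFrame φ ∧ ∃ ι₁ : L →+* ℂ, ι₁.comp j = φ 0 ∧
      ∃ t : Fin 4 → CMType K, IsPerLTypes φ t

/-- **The face hypotheses are inhabited**: there are a Galois CM field `F` with `[F:ℚ] ≥ 6`, a rank-four face `f`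
of `F` and an admissible embedding `ι₁`.  PROVED in `HodgeCM.Model.Inhabited` (`F = ℚ(ζ₇)`). -/
def FaceHypothesesInhabited : Prop :=
  ∃ F : CMField, IsGalois ℚ F ∧ 6 ≤ Module.finrank ℚ F ∧ ∃ (f : Face F) (ι₁ : F →+* ℂ), f.Admissible ι₁

namespace Universe

variable (U : Universe)

/-! ### The period-free shadow -/

/-- The **period-free shadow** of `U`: all primitives of `U` unchanged except the trace, which is `0` in every
degree on every variety. -/
def periodFree : Universe := { U with tr := fun _ _ => 0 }

/-- (Ported verbatim from the HodgeCMPerL package; no docstring in the source.) -/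
@[simp] theorem periodFree_tr (X : U.Var) (k : ℕ) : U.periodFree.tr X k = 0 := rfl

/- `cmProd F Θ = prodFin n …` is defined by structural recursion on `n`; with `n` a variable the elaborator's
smart unfolding refuses to unfold it, so the literal identities below are checked with `smartUnfolding false`
(the kernel comparison is the plain structural one). -/
set_option smartUnfolding false in
/-- (Ported verbatim from the HodgeCMPerL package; no docstring in the source.) -/
theorem periodFree_fact_cmDominated_iff : U.periodFree.Fact_cmDominated ↔ U.Fact_cmDominated := Iff.rfl

/-- The 28 model facts survive the passage to the period-free shadow. -/
theorem ModelAxioms.periodFree (M : U.ModelAxioms) : U.periodFree.ModelAxioms where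
  pull_id := M.pull_id
  pull_comp := M.pull_comp
  pull_cup := M.pull_cup
  pull_hodge := M.pull_hodge
  cup2_hodge := M.cup2_hodge
  tr_degree := fun _ _ _ => rfl
  alg_le_hodge := M.alg_le_hodge
  pull_alg := M.pull_alg
  cup_alg := M.cup_alg
  lefschetz11 := M.lefschetz11
  cmAV := M.cmAV
  eigenLine := M.eigenLine
  alphaLine := M.alphaLine
  cmDominated := U.periodFree_fact_cmDominated_iff.mpr M.cmDominated
  weilLine_rank := M.weilLine_rank
  weilLine_hodge := M.weilLine_hodge
  pms_dim := M.pms_dim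
  lift := M.lift
  cup_comm1 := M.cup_comm1
  cup_interchange := M.cup_interchange
  kunneth1 := M.kunneth1
  H1_rank := M.H1_rank
  H4_span := M.H4_span
  cmEnd := M.cmEnd
  conjIsogeny := M.conjIsogeny
  gysin_surface := fun S X f _ => ⟨0, Submodule.zero_mem _, fun _ => rfl⟩
  deg_diag := fun K Φ a Mm _ k => by
    change (0 : U.Coh _ k →ₗ[ℚ] ℚ) ∘ₗ U.pull Mm k = ((Algebra.norm ℚ a) ^ 4) • (0 : U.Coh _ k →ₗ[ℚ] ℚ)
    rw [LinearMap.zero_comp, smul_zero]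
  algDuality := M.algDuality

/-! ### All periods vanish -/

/-- (Ported verbatim from the HodgeCMPerL package; no docstring in the source.) -/
theorem periodFree_trC (X : U.Var) (k : ℕ) : U.periodFree.trC X k = 0 := by
  change (TensorProduct.AlgebraTensorModule.rid ℚ ℂ ℂ).toLinearMap ∘ₗ
      (0 : U.Coh X k →ₗ[ℚ] ℚ).baseChange ℂ = 0
  rw [LinearMap.baseChange_zero, LinearMap.comp_zero]

/-- (Ported verbatim from the HodgeCMPerL package; no docstring in the source.) -/
@[simp] theorem periodFree_period (X : U.Var) (ω : Fin 4 → U.CohC X 1) : U.periodFree.period X ω = 0 := by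
  change U.periodFree.trC X 4 _ = 0
  rw [periodFree_trC, LinearMap.zero_apply]

/-- In the period-free shadow the conclusion shape of PerL Thm 4.4 / rfwf Thm 4.1 is false for EVERY datum. -/
theorem not_periodNV_periodFree {L : CMField} (ι₁ : L →+* ℂ) (V : HermSpace3 L ι₁) (K : CMField)
    (Ψ : Fin 4 → CMType K) (σ : K →+* ℂ) : ¬ U.periodFree.PeriodNV ι₁ V K Ψ σ := by
  rintro ⟨Γ, F, α, -, hne⟩
  exact hne (U.periodFree_period _ _)

/-- rfwf Prop 2.2 (the surface criterion) holds VACUOUSLY in the period-free shadow. -/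
theorem periodFree_surfaceCriterion : U.periodFree.SurfaceCriterion := by
  intro F _ f ι₁ _ S _ Fm α _ hne
  exact absurd (U.periodFree_period _ _) hne

/-! ### No theta realisation when all periods vanish -/

variable {U} in
/-- If every quadrilinear period on every surface `P_Γ` of the tower of `(V₃,h)` vanishes, the theta-realisation
structure is EMPTY: by `lineField` some wedge `Λ Γ ω₁ ω₂` of theta one-forms is nonzero, but by `inner_Λ` its
Petersson norm is a multiple of the period `∫ ω₁ ∧ ω₂ ∧ \overline{ω₁ ∧ ω₂} = 0` (theta one-forms are `(1,0)`-classes: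
`Theta_sub`, `Uiso_le_H10`, which uses `Fact_pull_hodge`). -/
theorem isEmpty_thetaRealisation_of_period_eq_zero (hH : U.Fact_pull_hodge) {L : CMField} {ι₁ : L →+* ℂ}
    {V : HermSpace3 L ι₁} {K : CMField} {Ψ : Fin 4 → CMType K} {σ : K →+* ℂ}
    (h0 : ∀ (Γ : Level V) (ω : Fin 4 → U.CohC (U.pms L ι₁ V Γ) 1), U.period (U.pms L ι₁ V Γ) ω = 0) :
    IsEmpty (U.ThetaRealisation ι₁ V K Ψ σ) := by
  refine ⟨fun R => ?_⟩
  obtain ⟨Γ, ω₁, h₁, ω₂, h₂, hne⟩ := R.lineField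
  obtain ⟨c, -, hc⟩ := R.inner_Λ Γ
  have hω₁ : ω₁ ∈ U.H10 _ := Uiso_le_H10 hH Γ K (Ψ 0) σ (R.Theta_sub 0 Γ h₁)
  have hω₂ : ω₂ ∈ U.H10 _ := Uiso_le_H10 hH Γ K (Ψ 1) σ (R.Theta_sub 1 Γ h₂)
  let ω : Fin 4 → U.CohC (U.pms L ι₁ V Γ) 1 := fun i => match i with | 0 => ω₁ | 1 => ω₂ | 2 => ω₁ | 3 => ω₂
  have hω : ∀ i, ω i ∈ U.H10 _ := by
    intro i
    match i with
    | 0 => exact hω₁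
    | 1 => exact hω₂
    | 2 => exact hω₁
    | 3 => exact hω₂
  have key := hc ω hω
  rw [h0, mul_zero] at key
  exact hne (inner_self_eq_zero.mp key)

/-- In the period-free shadow of a universe with `Fact_pull_hodge` there is NO theta realisation, for any datum. -/
theorem isEmpty_thetaRealisation_periodFree (hH : U.Fact_pull_hodge) {L : CMField} (ι₁ : L →+* ℂ)
    (V : HermSpace3 L ι₁) (K : CMField) (Ψ : Fin 4 → CMType K) (σ : K →+* ℂ) :
    IsEmpty (U.periodFree.ThetaRealisation ι₁ V K Ψ σ) :=
  isEmpty_thetaRealisation_of_period_eq_zero (U := U.periodFree) hH fun _ ω => U.periodFree_period _ ω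

/-! ### The statements not mentioning the trace are literally unchanged -/

/-- (Ported verbatim from the HodgeCMPerL package; no docstring in the source.) -/
theorem periodFree_hc_cm_iff : U.periodFree.HC_CM ↔ U.HC_CM := Iff.rfl
/-- (Ported verbatim from the HodgeCMPerL package; no docstring in the source.) -/
theorem periodFree_hc_iff (X : U.Var) : U.periodFree.HC X ↔ U.HC X := Iff.rfl
/-- (Ported verbatim from the HodgeCMPerL package; no docstring in the source.) -/
theorem periodFree_weilFaceAlgebraic_iff (K : CMField) (f : Face K) :
    U.periodFree.WeilFaceAlgebraic K f ↔ U.WeilFaceAlgebraic K f := Iff.rfl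
/-- (Ported verbatim from the HodgeCMPerL package; no docstring in the source.) -/
theorem periodFree_w_rk4_iff : U.periodFree.W_RK4 ↔ U.W_RK4 := Iff.rfl
set_option smartUnfolding false in
/-- (Ported verbatim from the HodgeCMPerL package; no docstring in the source.) -/
theorem periodFree_faceReduction_iff : U.periodFree.FaceReduction ↔ U.FaceReduction := Iff.rfl
set_option smartUnfolding false in
/-- (Ported verbatim from the HodgeCMPerL package; no docstring in the source.) -/
theorem periodFree_lemma81_iff : U.periodFree.Lemma81 ↔ U.Lemma81 := Iff.rfl
set_option smartUnfolding false in
/-- (Ported verbatim from the HodgeCMPerL package; no docstring in the source.) -/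
theorem periodFree_pohlmannSpan_iff : U.periodFree.PohlmannSpan ↔ U.PohlmannSpan := Iff.rfl
set_option smartUnfolding false in
/-- (Ported verbatim from the HodgeCMPerL package; no docstring in the source.) -/
theorem periodFree_qw8Sufficiency_iff : U.periodFree.Qw8Sufficiency ↔ U.Qw8Sufficiency := Iff.rfl

/-! ### PerL-side statements in the shadow: true iff vacuous -/

/-- PerL Thm 4.4 holds in the period-free shadow iff PerL's hypotheses are uninhabited. -/
theorem periodFree_perL44_iff : U.periodFree.PerL44 ↔ ¬ PerLHypothesesInhabited := by
  constructor
  · rintro h ⟨K, L, j, hN, hK, hL, φ, hφ, ι₁, hι, t, ht⟩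
    obtain ⟨V⟩ := landherr_exists_proof L ι₁
    exact U.not_periodNV_periodFree ι₁ V K t (φ 0) (h K L j hN hK hL φ hφ ι₁ hι t ht V)
  · intro h K L j hN hK hL φ hφ ι₁ hι t ht V
    exact absurd ⟨K, L, j, hN, hK, hL, φ, hφ, ι₁, hι, t, ht⟩ h

/-- `W_per^L` (PerL verbatim) holds in the period-free shadow iff PerL's hypotheses are uninhabited. -/
theorem periodFree_perL_iff : U.periodFree.PerL ↔ ¬ PerLHypothesesInhabited := by
  constructor
  · rintro h ⟨K, L, j, hN, hK, hL, φ, hφ, ι₁, hι, t, ht⟩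
    obtain ⟨V, hV⟩ := h K L j hN hK hL φ hφ ι₁ hι t ht
    exact U.not_periodNV_periodFree ι₁ V K t (φ 0) hV
  · intro h K L j hN hK hL φ hφ ι₁ hι t ht
    exact absurd ⟨K, L, j, hN, hK, hL, φ, hφ, ι₁, hι, t, ht⟩ h

/-- The open input `RealisationExistsPerL` holds in the period-free shadow (of a universe with `Fact_pull_hodge`)
iff PerL's hypotheses are uninhabited. -/
theorem periodFree_realisationExistsPerL_iff (hH : U.Fact_pull_hodge) :
    U.periodFree.RealisationExistsPerL ↔ ¬ PerLHypothesesInhabited := by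
  constructor
  · rintro h ⟨K, L, j, hN, hK, hL, φ, hφ, ι₁, hι, t, ht⟩
    obtain ⟨V⟩ := landherr_exists_proof L ι₁
    exact (U.isEmpty_thetaRealisation_periodFree hH ι₁ V K t (φ 0)).false
      (h K L j hN hK hL φ hφ ι₁ hι t ht V).some
  · intro h K L j hN hK hL φ hφ ι₁ hι t ht
    exact absurd ⟨K, L, j, hN, hK, hL, φ, hφ, ι₁, hι, t, ht⟩ h

/-- rfwf Thm 4.1 (admissible form) holds in the period-free shadow iff the face hypotheses are uninhabited. -/
theorem periodFree_periodThmF_iff : U.periodFree.PeriodThmF ↔ ¬ FaceHypothesesInhabited := by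
  constructor
  · rintro h ⟨F, hG, h6, f, ι₁, hι⟩
    obtain ⟨V⟩ := landherr_exists_proof F ι₁
    exact U.not_periodNV_periodFree ι₁ V F f.psi ι₁ (h F hG h6 f ι₁ hι V)
  · intro h F hG h6 f ι₁ hι
    exact absurd ⟨F, hG, h6, f, ι₁, hι⟩ h

/-- The open input `RealisationExistsFace` holds in the period-free shadow (of a universe with `Fact_pull_hodge`)
iff the face hypotheses are uninhabited. -/
theorem periodFree_realisationExistsFace_iff (hH : U.Fact_pull_hodge) :
    U.periodFree.RealisationExistsFace ↔ ¬ FaceHypothesesInhabited := by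
  constructor
  · rintro h ⟨F, hG, h6, f, ι₁, hι⟩
    obtain ⟨V⟩ := landherr_exists_proof F ι₁
    exact (U.isEmpty_thetaRealisation_periodFree hH ι₁ V F f.psi ι₁).false (h F hG h6 f ι₁ hι V).some
  · intro h F hG h6 f ι₁ hι
    exact absurd ⟨F, hG, h6, f, ι₁, hι⟩ h

end Universe

end HodgeCM

end
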